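import Literature.Geometry.Symplectic.OrigamiMoserField
import Literature.Geometry.Symplectic.OrigamiFoldFirstOrderSign
import HarnessLib

/-!
# The origami Moser argument, IX: flatness of the fibre primitive and the oriented null action

Ninth file of the proof of the named fact `Literature.Geometry.Symplectic.exists_origamiCollarNormalForm`
(Cannas da Silva–Guillemin–Woodward 2000, Thm. 1), preparing the Moser data of the collar:

* `hasDerivAt_fibreCurve_fibrePrimitive` — **the fibre primitive of a smooth form vanishing on
  the zero section is flat to second order there**: `μ = fibrePrimitive η` satisfies
  `d/dt|₀ μ(n, t) = 0` (`μ(n, t) = t ∫₀¹ H_σ^*(ι_{(0,1)} η(n, σt)) dσ` with an integrand of norm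
  `O(t)`, McDuff–Salamon 2017, Lemma 3.2.1);
* `flipAct` — **the null circle action re-oriented component by component** (the orientation
  convention of Cannas da Silva–Guillemin–Pires, Def. 2.2: "the principal `S¹`-action matches the
  induced orientation of the null foliation"; on a possibly disconnected fold the given action or
  its reverse is taken on each component according to the sign of a continuous non-vanishing
  function `g`): again a smooth free action (`contMDiff_flipAct`, `flipAct_one`, `flipAct_mul`,
  `flipAct_free`), with orbit velocity `± X` (`mfderiv_flipAct_orbit`).

Everything here is proved; the definitions are explicit; no facts.

## References

* A. Cannas da Silva, V. Guillemin, C. Woodward, *On the unfolding of folded symplectic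
  structures*, Math. Res. Lett. 7 (2000), proof of Thm. 1. [CannasGuilleminWoodward2000]
* A. Cannas da Silva, V. Guillemin, A. R. Pires, *Symplectic Origami*, IMRN 2011 =
  arXiv:0909.4065, Def. 2.2. [CannasdasilvaGuilleminPires2010]
* D. McDuff, D. Salamon, *Introduction to Symplectic Topology*, 3rd ed. (2017), Lemma 3.2.1.
  [McDuffSalamon2017]
-/

noncomputable section

open scoped Manifold ContDiff Topology
open Set Function Filter Asymptotics
open Literature.Geometry.Kaehler Literature.Geometry.Manifold

namespace Literature.Geometry.Symplectic

namespace OrigamiMoser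

local notation "E3" => EuclideanSpace ℝ (Fin 3)
local notation "F4" => EuclideanSpace ℝ (Fin 3) × ℝ
local notation "I34" => ModelWithCorners.prod (𝓡 3) 𝓘(ℝ, ℝ)

variable {N : Type*} [TopologicalSpace N] [ChartedSpace (EuclideanSpace ℝ (Fin 3)) N]

/-! ### Flatness of the fibre primitive along the zero section -/

/-- The operator norm of `H_σ = id - (1 - σ) Q` for `σ ∈ [0, 1]`. [folklore] -/
theorem norm_linHom_vertQ_le {σ : ℝ} (hσ : σ ∈ Icc (0 : ℝ) 1) :
    ‖linHom (vertQ 3) σ‖ ≤ 1 + ‖vertQ 3‖ := by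
  rw [linHom]
  refine (norm_sub_le _ _).trans (add_le_add ContinuousLinearMap.norm_id_le ?_)
  rw [norm_smul, Real.norm_eq_abs, abs_of_nonneg (by linarith [hσ.2])]
  have h : (1 - σ) * ‖vertQ 3‖ ≤ 1 * ‖vertQ 3‖ :=
    mul_le_mul_of_nonneg_right (by linarith [hσ.1]) (norm_nonneg _)
  linarith

/-- The norm of the integrand of the fibre primitive of a `2`-form. [folklore] -/
theorem norm_fibreIntegrand_le (A : F4 [⋀^Fin 2]→L[ℝ] ℝ) (v : F4) {σ : ℝ} (hσ : σ ∈ Icc (0 : ℝ) 1) :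
    ‖(A.curryLeft v).compContinuousLinearMap (linHom (vertQ 3) σ)‖ ≤ ‖A‖ * ‖v‖ * (1 + ‖vertQ 3‖) := by
  refine (ContinuousAlternatingMap.norm_compContinuousLinearMap_le _ _).trans ?_
  rw [Fintype.card_fin, pow_one]
  have h1 : ‖A.curryLeft v‖ ≤ ‖A‖ * ‖v‖ := by
    have h := (A.curryLeft).le_opNorm v
    have hn : ‖A.curryLeft‖ = ‖A‖ := ContinuousAlternatingMap.curryLeftLI.norm_map A
    rwa [hn] at h
  exact mul_le_mul h1 (norm_linHom_vertQ_le hσ) (norm_nonneg _) (by positivity)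

variable [IsManifold (𝓡 3) ∞ N]

/-- **The fibre primitive of a smooth form vanishing on the zero section is flat there**:
`d/dt|₀ (fibrePrimitive η)(n, t) = 0`. [cite: McDuffSalamon2017, Lemma 3.2.1] -/
theorem hasDerivAt_fibreCurve_fibrePrimitive {η : MForm I34 (N × ℝ) ℝ 2} (hη : IsSmoothForm η)
    (h0 : ∀ n, η (n, 0) = 0) (n : N) :
    HasDerivAt (fibreCurve (fibrePrimitive η) n) 0 0 := by
  -- the norm of `η (n, r)` is `O(r)`
  have hcurve := contDiff_fibreCurve hη n
  have hd : HasDerivAt (fibreCurve η n) (deriv (fibreCurve η n) 0) 0 :=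
    (hcurve.differentiable (by simp) 0).hasDerivAt
  have hO := hd.isBigO_sub
  obtain ⟨C, hC⟩ := hO.bound
  have hC0 : fibreCurve η n 0 = 0 := h0 n
  simp only [hC0, sub_zero] at hC
  obtain ⟨ε, hε, hball⟩ := Metric.eventually_nhds_iff.1 hC
  have hbound : ∀ r : ℝ, |r| < ε → ‖fibreCurve η n r‖ ≤ C * |r| := by
    intro r hr
    have h := hball (by rwa [Real.dist_eq, sub_zero])
    rwa [Real.norm_eq_abs] at h
  have hCnn : 0 ≤ C := by
    have h := hbound (ε / 2) (by rw [abs_of_pos (by positivity)]; linarith)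
    have hpos : 0 < |ε / 2| := by rw [abs_of_pos (by positivity)]; positivity
    nlinarith [norm_nonneg (fibreCurve η n (ε / 2)), h, hpos]
  -- the constant
  set K : ℝ := C * ‖(((0 : E3), (1 : ℝ)) : F4)‖ * (1 + ‖vertQ 3‖) with hK
  have hKnn : 0 ≤ K := by positivity
  -- the quadratic bound
  have hquad : ∀ t : ℝ, |t| < ε → ‖fibreCurve (fibrePrimitive η) n t‖ ≤ K * t ^ 2 := by
    intro t ht
    rw [fibreCurve_apply, fibrePrimitive_eq_smul, norm_smul, Real.norm_eq_abs]
    have hint : ‖∫ σ in (0 : ℝ)..1,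
        (((η (n, σ * t) : F4 [⋀^Fin 2]→L[ℝ] ℝ)).curryLeft (((0 : E3), (1 : ℝ)) : F4)).compContinuousLinearMap
          (linHom (vertQ 3) σ)‖ ≤ (K * |t|) * |1 - 0| := by
      refine intervalIntegral.norm_integral_le_of_norm_le_const fun σ hσ => ?_
      rw [uIoc_of_le zero_le_one] at hσ
      have hσ' : σ ∈ Icc (0 : ℝ) 1 := ⟨hσ.1.le, hσ.2⟩
      refine (norm_fibreIntegrand_le _ _ hσ').trans ?_
      have hst : |σ * t| < ε := by
        rw [abs_mul]
        calc |σ| * |t| ≤ 1 * |t| := mul_le_mul_of_nonneg_right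
              (by rw [abs_of_nonneg hσ.1.le]; exact hσ.2) (abs_nonneg t)
          _ = |t| := one_mul _
          _ < ε := ht
      have hη := hbound (σ * t) hst
      have hle : ‖fibreCurve η n (σ * t)‖ ≤ C * |t| := by
        calc ‖fibreCurve η n (σ * t)‖ ≤ C * |σ * t| := hη
          _ = C * (σ * |t|) := by rw [abs_mul, abs_of_nonneg hσ.1.le]
          _ ≤ C * (1 * |t|) := by gcongr; exact hσ.2
          _ = C * |t| := by ring
      calc ‖fibreCurve η n (σ * t)‖ * ‖(((0 : E3), (1 : ℝ)) : F4)‖ * (1 + ‖vertQ 3‖)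
          ≤ (C * |t|) * ‖(((0 : E3), (1 : ℝ)) : F4)‖ * (1 + ‖vertQ 3‖) := by gcongr
        _ = K * |t| := by rw [hK]; ring
    rw [sub_zero, abs_one, mul_one] at hint
    calc |t| * ‖∫ σ in (0 : ℝ)..1, _‖ ≤ |t| * (K * |t|) := mul_le_mul_of_nonneg_left hint (abs_nonneg t)
      _ = K * t ^ 2 := by rw [← sq_abs]; ring
  -- conclusion
  rw [hasDerivAt_iff_isLittleO_nhds_zero]
  have hf0 : fibreCurve (fibrePrimitive η) n 0 = 0 := fibrePrimitive_apply_zero η n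
  simp only [zero_add, hf0, sub_zero, smul_zero]
  rw [isLittleO_iff]
  intro c hc
  have hδ : 0 < min ε (c / (K + 1)) := lt_min hε (div_pos hc (by positivity))
  filter_upwards [Metric.ball_mem_nhds (0 : ℝ) hδ] with h hh
  rw [Metric.mem_ball, Real.dist_eq, sub_zero] at hh
  have h1 := hquad h (lt_of_lt_of_le hh (min_le_left _ _))
  have h2 : |h| < c / (K + 1) := lt_of_lt_of_le hh (min_le_right _ _)
  rw [Real.norm_eq_abs]
  calc ‖fibreCurve (fibrePrimitive η) n h‖ ≤ K * h ^ 2 := h1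
    _ = (K * |h|) * |h| := by rw [← sq_abs]; ring
    _ ≤ ((K + 1) * (c / (K + 1))) * |h| := by
        refine mul_le_mul_of_nonneg_right ?_ (abs_nonneg h)
        nlinarith [abs_nonneg h, h2.le]
    _ = c * |h| := by rw [mul_div_cancel₀ _ (by positivity)]

/-! ### The re-oriented null action -/

section Flip

variable {N' : Type} [TopologicalSpace N'] [ChartedSpace (EuclideanSpace ℝ (Fin 3)) N']

/-- **The re-oriented action**: `θ a` on `{g > 0}`, `θ a⁻¹` elsewhere. [cite: CannasdasilvaGuilleminPires2010, Def. 2.2] -/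
def flipAct (θ : Circle → N' → N') (g : N' → ℝ) (a : Circle) (n : N') : N' :=
  θ (if 0 < g n then a else a⁻¹) n

omit [TopologicalSpace N'] [ChartedSpace (EuclideanSpace ℝ (Fin 3)) N'] in
/-- The re-oriented action at the unit. [folklore] -/
theorem flipAct_one {θ : Circle → N' → N'} (h1 : ∀ n, θ 1 n = n) (g : N' → ℝ) (n : N') :
    flipAct θ g 1 n = n := by
  unfold flipAct
  split_ifs
  · exact h1 n
  · rw [inv_one]; exact h1 n

/-- **The sign of `g` is constant along orbits** (the orbit through `n` is a continuous image of
the circle, hence connected, and `g` does not vanish). [folklore] -/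
theorem g_pos_iff {θ : Circle → N' → N'}
    (hθ : ContMDiff ((𝓡 1).prod (𝓡 3)) (𝓡 3) ∞ (fun p : Circle × N' => θ p.1 p.2))
    (h1 : ∀ n, θ 1 n = n) {g : N' → ℝ} (hg : Continuous g) (hg0 : ∀ n, g n ≠ 0)
    (a : Circle) (n : N') : 0 < g (θ a n) ↔ 0 < g n := by
  obtain ⟨s, rfl⟩ := Circle.exp_surjective a
  set γ : ℝ → ℝ := fun τ => g (θ (Circle.exp (τ * s)) n) with hγ
  have hpath : Continuous fun τ : ℝ => θ (Circle.exp (τ * s)) n :=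
    hθ.continuous.comp (f := fun τ : ℝ => ((Circle.exp (τ * s), n) : Circle × N'))
      ((Circle.exp.continuous.comp (continuous_id.mul continuous_const)).prodMk continuous_const)
  have hγc : Continuous γ := hg.comp hpath
  have hγ0 : γ 0 = g n := by
    show g (θ (Circle.exp (0 * s)) n) = g n
    rw [zero_mul, Circle.exp_zero, h1]
  have hγ1 : γ 1 = g (θ (Circle.exp s) n) := by
    show g (θ (Circle.exp (1 * s)) n) = _
    rw [one_mul]
  have hne : ∀ τ, γ τ ≠ 0 := fun τ => hg0 _
  have key : ∀ {u v : ℝ}, 0 < γ u → ¬ γ v < 0 := by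
    intro u v hu hv
    rcases le_total u v with huv | hvu
    · obtain ⟨τ, -, hτ⟩ := intermediate_value_Icc' huv hγc.continuousOn ⟨hv.le, hu.le⟩
      exact hne τ hτ
    · obtain ⟨τ, -, hτ⟩ := intermediate_value_Icc hvu hγc.continuousOn ⟨hv.le, hu.le⟩
      exact hne τ hτ
  rw [← hγ1, ← hγ0]
  constructor
  · intro h
    rcases lt_trichotomy (γ 0) 0 with h0 | h0 | h0
    · exact absurd h0 (key h)
    · exact absurd h0 (hne 0)
    · exact h0
  · intro h
    rcases lt_trichotomy (γ 1) 0 with h0 | h0 | h0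
    · exact absurd h0 (key h)
    · exact absurd h0 (hne 1)
    · exact h0

/-- The re-oriented action is multiplicative. [folklore] -/
theorem flipAct_mul {θ : Circle → N' → N'}
    (hθ : ContMDiff ((𝓡 1).prod (𝓡 3)) (𝓡 3) ∞ (fun p : Circle × N' => θ p.1 p.2))
    (h1 : ∀ n, θ 1 n = n) (hmul : ∀ a b n, θ (a * b) n = θ a (θ b n))
    {g : N' → ℝ} (hg : Continuous g) (hg0 : ∀ n, g n ≠ 0) (a b : Circle) (n : N') :
    flipAct θ g (a * b) n = flipAct θ g a (flipAct θ g b n) := by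
  unfold flipAct
  by_cases hn : 0 < g n
  · have hbn : 0 < g (θ b n) := (g_pos_iff hθ h1 hg hg0 b n).2 hn
    rw [if_pos hn, if_pos hn, if_pos hbn, hmul]
  · have hbn : ¬ 0 < g (θ b⁻¹ n) := fun h => hn ((g_pos_iff hθ h1 hg hg0 b⁻¹ n).1 h)
    rw [if_neg hn, if_neg hn, if_neg hbn, mul_inv_rev, mul_comm b⁻¹ a⁻¹, hmul]

omit [TopologicalSpace N'] [ChartedSpace (EuclideanSpace ℝ (Fin 3)) N'] in
/-- The re-oriented action is free. [folklore] -/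
theorem flipAct_free {θ : Circle → N' → N'} (hfree : ∀ a n, θ a n = n → a = 1) (g : N' → ℝ)
    (a : Circle) (n : N') (h : flipAct θ g a n = n) : a = 1 := by
  unfold flipAct at h
  split_ifs at h with hn
  · exact hfree a n h
  · exact inv_eq_one.1 (hfree a⁻¹ n h)

/-- **The re-oriented action is smooth** (locally it is `θ` or its reverse, on the open sets
`{g > 0}`, `{g < 0}` which cover `N`). [folklore] -/
theorem contMDiff_flipAct {θ : Circle → N' → N'}
    (hθ : ContMDiff ((𝓡 1).prod (𝓡 3)) (𝓡 3) ∞ (fun p : Circle × N' => θ p.1 p.2))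
    {g : N' → ℝ} (hg : Continuous g) (hg0 : ∀ n, g n ≠ 0) :
    ContMDiff ((𝓡 1).prod (𝓡 3)) (𝓡 3) ∞ (fun p : Circle × N' => flipAct θ g p.1 p.2) := by
  intro p
  have hinv : ContMDiff ((𝓡 1).prod (𝓡 3)) (𝓡 3) ∞ (fun p : Circle × N' => θ p.1⁻¹ p.2) :=
    hθ.comp (((contMDiff_inv (𝓡 1) ∞).comp contMDiff_fst).prodMk contMDiff_snd)
  by_cases hp : 0 < g p.2
  · have hopen : IsOpen {q : Circle × N' | 0 < g q.2} := isOpen_lt continuous_const (hg.comp continuous_snd)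
    have hev : (fun q : Circle × N' => flipAct θ g q.1 q.2) =ᶠ[𝓝 p] fun q => θ q.1 q.2 := by
      filter_upwards [hopen.mem_nhds hp] with q hq
      show θ (if 0 < g q.2 then q.1 else q.1⁻¹) q.2 = θ q.1 q.2
      rw [if_pos hq]
    exact (hθ p).congr_of_eventuallyEq hev
  · have hlt : g p.2 < 0 := lt_of_le_of_ne (not_lt.1 hp) (hg0 p.2)
    have hopen : IsOpen {q : Circle × N' | g q.2 < 0} := isOpen_lt (hg.comp continuous_snd) continuous_const
    have hev : (fun q : Circle × N' => flipAct θ g q.1 q.2) =ᶠ[𝓝 p] fun q => θ q.1⁻¹ q.2 := by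
      filter_upwards [hopen.mem_nhds hlt] with q hq
      show θ (if 0 < g q.2 then q.1 else q.1⁻¹) q.2 = θ q.1⁻¹ q.2
      rw [if_neg (not_lt.2 hq.le)]
    exact (hinv p).congr_of_eventuallyEq hev

/-- **The orbit velocity of the re-oriented action is `± X`**: `X` on `{g > 0}`, `-X` on `{g < 0}`.
[folklore] -/
theorem mfderiv_flipAct_orbit {θ : Circle → N' → N'}
    (hθ : ContMDiff ((𝓡 1).prod (𝓡 3)) (𝓡 3) ∞ (fun p : Circle × N' => θ p.1 p.2))
    (g : N' → ℝ) (n : N') :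
    mfderiv 𝓘(ℝ, ℝ) (𝓡 3) (fun t : ℝ => flipAct θ g (Circle.exp t) n) 0 (1 : ℝ) =
      (if 0 < g n then (1 : ℝ) else -1) •
        mfderiv 𝓘(ℝ, ℝ) (𝓡 3) (fun t : ℝ => θ (Circle.exp t) n) 0 (1 : ℝ) := by
  by_cases hn : 0 < g n
  · have h : (fun t : ℝ => flipAct θ g (Circle.exp t) n) = fun t : ℝ => θ (Circle.exp t) n := by
      funext t; show θ (if 0 < g n then Circle.exp t else (Circle.exp t)⁻¹) n = _; rw [if_pos hn]
    have hmf := (Filter.EventuallyEq.of_eq h).mfderiv_eq (I := 𝓘(ℝ, ℝ)) (I' := 𝓡 3) (x := (0 : ℝ))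
    rw [if_pos hn, one_smul]
    exact congrArg (fun L => L (1 : ℝ)) hmf
  · have h : (fun t : ℝ => flipAct θ g (Circle.exp t) n) = fun t : ℝ => θ (Circle.exp t)⁻¹ n := by
      funext t; show θ (if 0 < g n then Circle.exp t else (Circle.exp t)⁻¹) n = _; rw [if_neg hn]
    have hmf := (Filter.EventuallyEq.of_eq h).mfderiv_eq (I := 𝓘(ℝ, ℝ)) (I' := 𝓡 3) (x := (0 : ℝ))
    rw [if_neg hn, neg_one_smul]
    exact (congrArg (fun L => L (1 : ℝ)) hmf).trans (mfderiv_circleOrbit_inv hθ n)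

end Flip

end OrigamiMoser

end Literature.Geometry.Symplectic

end
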